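import Mathlib
import Literature.NumberTheory.LFunctions.Zhang2022.Section10RangeToolkit
import Literature.NumberTheory.LFunctions.Zhang2022.TypedSection10B
import Literature.NumberTheory.LFunctions.Zhang2022.Section8cStatements
import Literature.NumberTheory.LFunctions.Zhang2022.SkeletonReductions
import HarnessLib

/-!
# Zhang (2022) §10 p. 57: the range evaluations of the `Θ₁(𝐚₁₁,𝐚₁₃)` block, first lines
# (`Z22:§10.u037` / `u038`, `Typed.Sec10B.Eq1037a` …) DISCHARGED from Lemma 10.2, Lemma 8.2, (8.10)

Topic `Literature/NumberTheory/LFunctions/Zhang2022` (Landau–Siegel adjudication tree;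
verdict-neutral). Y. Zhang, *Discrete mean estimates and the Landau–Siegel zero*,
arXiv:2211.02515v1 (2022) [Zhang2022LandauSiegel], §10 «Proof of Proposition 2.4», PDF p. 57
(tex L2932): in the evaluation of `Sⱼ(𝐚₁₁,𝐚₁₃)`, "By Lemma 10.2 and the results in Section 8, …
the sum over `P^{0.5} ≤ dr < P^{0.502}` is equal to
`(500L′(1,χ)²/(0.504 log²P)) Σ_{P^{0.5}≤n<P^{0.502}} |χ(n)|λ₀ⱼ(n)φ(n)⁻¹ 𝔣_{j6}(P^{0.504}/n)(−1 + 𝔶₁ⱼ(n)) + o(α)`"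
(typed by L3-t2 as `Typed.Sec10B.Eq1037a c′`, campaign cell siegel-zhang, DAG node `Z22:§10.u037`,
cone C26 / `Ded1017`).

What "Lemma 10.2 and the results in Section 8" means here, made explicit and kernel-checked:
* the `n`-sum of `Sⱼ(𝐚₁₁,𝐚₁₃)` at `(d,r)` IS `𝔳₂ⱼ(d,r)` of Lemma 10.2 (`nSum13_eq_frakv2`), and
  Lemma 10.2 ((10.9) on `P^{0.5} < dr ≤ P^{0.502}/T`, (10.11) on the two `T`-windows) is the leaf
  CLAIM `Skeleton.Lemma102 c′` — a HYPOTHESIS here;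
* the `m`-sum at `dr = n ≥ P^{0.5}` is `(log P₁)⁻¹` times the sum of Lemma 8.2 at `x = P₁/n ∈ (T, P)`
  (`mSum11_eq`; the `ι₂ϰ₂` part vanishes since `n > P₂`), and Lemma 8.2 is the node
  `Skeleton.Lemma82 c′` — a hypothesis (a tree THEOREM for `c′ ≥ 0`, `Skeleton.lemma82_holds`);
* the substitution `n = dr` and (8.10) `Σ_{n=dr}|μ(r)|Π(d,r)/φ(r) = n/φ(n)` (typed node
  `Section8cStatements.Eq810`, L2 — a hypothesis) collapse the `(d,r)`-sum to the printed `n`-sum;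
* the error terms (`O(𝓛⁻¹⁵)` from (10.9), `O(𝓛⁻⁶)/log P₁` from Lemma 8.2, `O(𝓛⁻⁷)` on the windows)
  are summed against the weights with the crude majorants of `Section10RangeToolkit`
  (`|λ₀ⱼ| ≤ (n/φ(n))⁴`, `Σ_{r∣n sqfree}φ(r)⁻¹ = n/φ(n)`, `Σ_{Y<n≤X}(n/φ(n))⁵/n ≪ 1 + log(X/Y)`):
  total `≪ 𝓛⁻¹³ + 𝓛^{−12.9} = o(α)`, `α = π𝓛⁻⁹`.

**Every proposition named is a CLAIM of an unrefereed manuscript under adjudication; this file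
proves the implication «Lemma 10.2 ∧ Lemma 8.2 ∧ (8.10) ⇒ the display» only.** No new definitions,
no named facts; nothing here bears on Theorems 1–2 of the source or on Landau–Siegel zeros.

## References

* Y. Zhang, arXiv:2211.02515v1 (2022), §10 p. 57 (tex L2925–2945), Lemma 10.2 p. 55, Lemma 8.2
  p. 46, (8.10) p. 48. [cite: Zhang2022LandauSiegel, §10 p.57]
-/

noncomputable section

open Complex Real Finset

namespace Literature.NumberTheory.LFunctions.Zhang2022.Skeleton

open Literature.NumberTheory.LFunctions.Zhang2022.Typed
open Literature.NumberTheory.LFunctions.Zhang2022.Section8cProofs (betaJ_eq_real_mul_I beta1_eq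
  beta2_eq beta3_eq abs_b_le large_D)

/-! ## The `m`-sum of `Sⱼ(𝐚₁₁,𝐚₁₃)` at `n ≥ P₂` is Lemma 8.2's sum at `x = P₁/n`, over `log P₁` -/

variable (c' : ℝ) {D : ℕ} (χ : DirichletCharacter ℂ D)

/-- For `𝓛 ≥ 2` and `n ≥ P₂` (`n ≥ 1`): the `m`-sum `Σ_m χ(m)(ϰ₁(nm) + ι₂ϰ₂(nm))m^{−(1−β_j)}` of
`Sⱼ(𝐚₁₁,𝐚₁₃)` equals `(log P₁)⁻¹ Σ_{m<x} χ(m)m^{β_j−1}(x/m)^{β₆}log(x/m)` with `x = P₁/n` — the sum of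
Lemma 8.2 (`μ = 6`): `ϰ₂(nm) = 0` as `nm ≥ n ≥ P₂`, and `ϰ₁(nm) = log(x/m)/log P₁·(x/m)^{β₆}` for
`m < x`, `0` for `m ≥ x`. [cite: Zhang2022LandauSiegel, §10 p. 57] -/
theorem mSum11_eq (hD : 2 ≤ Real.log D) (j : ℕ) {n : ℕ} (hn1 : 1 ≤ n) (hn : P2 D ≤ (n : ℝ)) :
    Sec10B.mSum11 c' χ j n =
      (1 / (Real.log (P1 D) : ℂ)) * ∑ m ∈ Finset.Ico 1 ⌈P1 D / n⌉₊,
        χ (m : ZMod D) / (m : ℂ) ^ (1 - betaJ c' D j) *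
          (((P1 D / n) / m : ℝ) : ℂ) ^ beta6 D * (Real.log ((P1 D / n) / m) : ℂ) := by
  classical
  set x : ℝ := P1 D / n with hx
  have hn0 : (0 : ℝ) < n := by exact_mod_cast hn1
  have hP : 1 < bigP D := by
    rw [bigP]; exact Real.one_lt_exp_iff.mpr (by rw [ell]; positivity)
  have hP1pos : 0 < P1 D := Real.rpow_pos_of_pos (lt_trans zero_lt_one hP) _
  have hP1gt : 1 < P1 D := Real.one_lt_rpow hP (by norm_num)
  have hlogP1 : 0 < Real.log (P1 D) := Real.log_pos hP1gt
  have hx0 : 0 < x := div_pos hP1pos hn0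
  -- the index range `Ico 1 ⌈x⌉` sits inside `Ico 1 ⌈PT⁻²⌉`
  have hxP1 : x ≤ P1 D := by
    rw [hx, div_le_iff₀ hn0]
    have : (1 : ℝ) ≤ n := by exact_mod_cast hn1
    nlinarith
  have hceil : ⌈x⌉₊ ≤ Nsupp D := le_trans (Nat.ceil_mono hxP1) (ceil_P1_le_Nsupp D hD)
  rw [Sec10B.mSum11]
  -- drop `ϰ₂` and the terms `m ≥ x`
  have hterm : ∀ m ∈ Finset.Ico 1 (Nsupp D),
      χ (m : ZMod D) * (vk1 D (n * m) + iota2 * vk2 D (n * m)) / (m : ℂ) ^ (1 - betaJ c' D j) =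
        if m < ⌈x⌉₊ then
          (1 / (Real.log (P1 D) : ℂ)) * (χ (m : ZMod D) / (m : ℂ) ^ (1 - betaJ c' D j) *
            ((x / m : ℝ) : ℂ) ^ beta6 D * (Real.log (x / m) : ℂ)) else 0 := by
    intro m hm
    have hm1 : 1 ≤ m := (Finset.mem_Ico.mp hm).1
    have hm0 : (0 : ℝ) < m := by exact_mod_cast hm1
    have hnm : ((n * m : ℕ) : ℝ) = (n : ℝ) * m := by push_cast; ring
    have hvk2 : vk2 D (n * m) = 0 := by
      refine vk2_eq_zero ?_
      rw [hnm]
      have : (n : ℝ) ≤ n * m := by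
        have : (1 : ℝ) ≤ m := by exact_mod_cast hm1
        nlinarith
      exact hn.trans this
    rw [hvk2, mul_zero, add_zero]
    split_ifs with hmx
    · -- `m < x`: `ϰ₁(nm) = log(x/m)/log P₁ · (x/m)^{β₆}`
      have hmx' : (m : ℝ) < x := Nat.lt_ceil.mp hmx
      have hnmP : ((n * m : ℕ) : ℝ) < P1 D := by
        rw [hnm, hx] at *
        rwa [lt_div_iff₀ hn0, mul_comm] at hmx'
      have hvk1 : vk1 D (n * m) =
          (1 - Real.log ((n * m : ℕ) : ℝ) / Real.log (P1 D) : ℝ) *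
            ((P1 D / ((n * m : ℕ) : ℝ) : ℝ) : ℂ) ^ beta6 D := by
        rw [vk1, if_pos hnmP]
      have hquot : P1 D / ((n * m : ℕ) : ℝ) = x / m := by
        rw [hnm, hx, div_div]
      have hcoef : (1 - Real.log ((n * m : ℕ) : ℝ) / Real.log (P1 D)) =
          Real.log (x / m) / Real.log (P1 D) := by
        rw [← hquot, Real.log_div hP1pos.ne' (by rw [hnm]; positivity)]
        field_simp
      rw [hvk1, hquot, hcoef]
      push_cast
      ring
    · -- `m ≥ x`: `ϰ₁(nm) = 0`
      have hmx' : x ≤ m := by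
        have := Nat.le_of_not_lt hmx
        exact le_trans (Nat.le_ceil x) (by exact_mod_cast this)
      have hnmP : P1 D ≤ ((n * m : ℕ) : ℝ) := by
        rw [hnm]
        rw [hx, div_le_iff₀ hn0] at hmx'
        linarith [mul_comm (m : ℝ) n]
      rw [vk1_eq_zero hnmP]
      simp
  rw [Finset.sum_congr rfl hterm, ← Finset.sum_filter, Finset.mul_sum]
  congr 1
  ext m
  simp only [Finset.mem_filter, Finset.mem_Ico]
  constructor
  · rintro ⟨⟨h1, -⟩, h3⟩; exact ⟨h1, h3⟩
  · rintro ⟨h1, h3⟩; exact ⟨⟨h1, lt_of_lt_of_le h3 hceil⟩, h3⟩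

/-! ## The `n`-sum of `Sⱼ(𝐚₁₁,𝐚₁₃)` is `𝔳₂ⱼ(d,r)` -/

/-- A sum over `1 ≤ n < B` whose summand vanishes for `n ≥ K` (`K ≤ B`) is the sum over `1 ≤ n < K`.
[cite: Zhang2022LandauSiegel, §10 p. 57] -/
private theorem sum_Ico_eq_of_vanish {M : Type*} [AddCommMonoid M] {f : ℕ → M} {K B : ℕ}
    (hKB : K ≤ B) (hf : ∀ n, K ≤ n → f n = 0) :
    ∑ n ∈ Finset.Ico 1 B, f n = ∑ n ∈ Finset.Ico 1 K, f n := by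
  refine (Finset.sum_subset (Finset.Ico_subset_Ico_right hKB) fun n hn hn' => ?_).symm
  refine hf n ?_
  simp only [Finset.mem_Ico, not_and, not_lt] at hn hn'
  exact hn' hn.1

/-- For `𝓛 ≥ 2`, `d, r ≥ 1`: the `n`-sum `Σ_n χ(n)f̃(log(drn)/log P)ξ₀ⱼ(n;d,r)n⁻¹` of `Sⱼ(𝐚₁₁,𝐚₁₃)`
(truncated at `PT⁻²`) IS `𝔳₂ⱼ(d,r)` of Lemma 10.2 (truncated at `P`): both truncations are vacuous,
`f̃(log k/log P) = 0` for `k > P₁ = P^{0.504}`. [cite: Zhang2022LandauSiegel, §10 p. 57, Lemma 10.2] -/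
theorem nSum13_eq_frakv2 (hD : 2 ≤ Real.log D) (j : ℕ) {d r : ℕ} (hd : 1 ≤ d) (hr : 1 ≤ r) :
    Sec10B.nSum13 c' χ j d r = frakv2 c' χ j d r := by
  classical
  set K : ℕ := ⌊P1 D⌋₊ + 1 with hK
  have hP : 1 < bigP D := by
    rw [bigP]; exact Real.one_lt_exp_iff.mpr (by rw [ell]; positivity)
  have hP1lt : P1 D < bigP D := by
    rw [P1]
    exact Real.rpow_lt_self_of_one_lt hP (by norm_num)
  have hP10 : 0 ≤ P1 D := (Real.rpow_pos_of_pos (lt_trans zero_lt_one hP) _).le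
  have hKN : K ≤ Nsupp D := by
    rw [hK, Nsupp, Nat.add_one_le_iff]
    exact Nat.lt_ceil.mpr (lt_of_le_of_lt (Nat.floor_le hP10) (P1_lt_P_div_T_sq D hD))
  have hKP : K ≤ ⌈bigP D⌉₊ := by
    rw [hK, Nat.add_one_le_iff]
    exact Nat.lt_ceil.mpr (lt_of_le_of_lt (Nat.floor_le hP10) hP1lt)
  have hvan : ∀ n, K ≤ n →
      χ (n : ZMod D) * (ftilde (Real.log ((d * r * n : ℕ) : ℝ) / Real.log (bigP D)) : ℂ) *
        xiZero c' D j n d r / (n : ℂ) = 0 := by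
    intro n hn
    have hnP1 : P1 D < n := by
      have : ⌊P1 D⌋₊ < n := by rw [hK] at hn; omega
      exact (Nat.floor_lt hP10).mp this
    have hk : P1 D < ((d * r * n : ℕ) : ℝ) := by
      refine lt_of_lt_of_le hnP1 ?_
      have : n ≤ d * r * n := Nat.le_mul_of_pos_left n (Nat.mul_pos hd hr)
      exact_mod_cast this
    have h0 := ftilde_log_eq_zero_of_P1_lt D hD hk (c := 0) le_rfl
    rw [add_zero] at h0
    rw [h0]
    simp
  rw [Sec10B.nSum13, frakv2, sum_Ico_eq_of_vanish hKN hvan, sum_Ico_eq_of_vanish hKP hvan]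

/-! ## Crude bounds for the factors -/

/-- `‖β_j‖ ≤ 6α` once `|c′|α𝓛 ≤ 1`. [cite: Zhang2022LandauSiegel, §2 (2.13)] -/
theorem norm_betaJ_le {c' : ℝ} {D : ℕ} (h : |c'| * alpha D * ell D ≤ 1) (hα : 0 ≤ alpha D)
    (hℓ : 0 ≤ ell D) (j : ℕ) : ‖betaJ c' D j‖ ≤ 6 * alpha D := by
  obtain ⟨b, hb, hb'⟩ := betaJ_eq_real_mul_I c' D j
  rw [hb, norm_mul, Complex.norm_real, Complex.norm_I, mul_one, Real.norm_eq_abs]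
  exact abs_b_le h hα hℓ hb'

/-- `‖β₆‖ = 3α/2` (`α ≥ 0`). [cite: Zhang2022LandauSiegel, §2 (2.22)] -/
theorem norm_beta6 {D : ℕ} (hα : 0 ≤ alpha D) : ‖beta6 D‖ = 3 * alpha D / 2 := by
  rw [beta6, norm_div, norm_mul, norm_mul, Complex.norm_I, Complex.norm_real,
    Real.norm_of_nonneg hα]
  norm_num

/-- **`|𝔣_{j6}(x)| ≤ 32`** for `x > 0` with `|log x| ≤ 𝓛⁹` (once `|c′|α𝓛 ≤ 1`):
`𝔣_{j6}(x) = (1 + (β₆ − β_j)log x)x^{β₆}` with `|x^{β₆}| = 1`, `|β₆ − β_j| ≤ 7.5α = 7.5π𝓛⁻⁹`.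
[cite: Zhang2022LandauSiegel, §8 Lemma 8.2] -/
theorem norm_frakfW_six_le {c' : ℝ} {D : ℕ} (h : |c'| * alpha D * ell D ≤ 1) (hα : 0 < alpha D)
    (hαL : alpha D * ell D ^ 9 = π) (hℓ : 0 ≤ ell D) (j : ℕ) {x : ℝ}
    (hlx : |Real.log x| ≤ ell D ^ 9) : ‖frakfW c' D j 6 x‖ ≤ 32 := by
  have hμ : betaMu D 6 = beta6 D := by simp [betaMu]
  rw [frakfW, hμ, frakf, norm_mul]
  have hexp : ‖cexp (beta6 D * (Real.log x : ℂ))‖ = 1 := by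
    rw [Complex.norm_exp]
    have : (beta6 D * (Real.log x : ℂ)).re = 0 := by simp [beta6]
    rw [this, Real.exp_zero]
  rw [hexp, mul_one]
  have hb : ‖beta6 D - betaJ c' D j‖ ≤ 15 / 2 * alpha D := by
    calc ‖beta6 D - betaJ c' D j‖ ≤ ‖beta6 D‖ + ‖betaJ c' D j‖ := norm_sub_le _ _
      _ ≤ 3 * alpha D / 2 + 6 * alpha D := add_le_add (norm_beta6 hα.le).le (norm_betaJ_le h hα.le hℓ j)
      _ = 15 / 2 * alpha D := by ring
  calc ‖1 + (beta6 D - betaJ c' D j) * (Real.log x : ℂ)‖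
      ≤ ‖(1 : ℂ)‖ + ‖(beta6 D - betaJ c' D j) * (Real.log x : ℂ)‖ := norm_add_le _ _
    _ = 1 + ‖beta6 D - betaJ c' D j‖ * |Real.log x| := by
        rw [norm_one, norm_mul, Complex.norm_real, Real.norm_eq_abs]
    _ ≤ 1 + 15 / 2 * alpha D * ell D ^ 9 := by gcongr
    _ = 1 + 15 / 2 * π := by rw [mul_assoc, hαL]
    _ ≤ 32 := by nlinarith [Real.pi_lt_four]

/-- **`|−1 + 𝔶₁ⱼ(y)| ≤ 2`** when the three logarithms in (10.9) are at most `0.004𝓛⁹` in size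
(the case `P^{0.5} ≤ y ≤ P^{0.504}`), once `|c′|α𝓛 ≤ 1`: `|β| ≤ 6α`, `α𝓛⁹ = π`.
[cite: Zhang2022LandauSiegel, §10 (10.9)] -/
theorem norm_fraky1_sub_le {c' : ℝ} {D : ℕ} (h : |c'| * alpha D * ell D ≤ 1) (hα : 0 < alpha D)
    (hαL : alpha D * ell D ^ 9 = π) (hℓ : 0 ≤ ell D) (j : ℕ) {y : ℝ}
    (h1 : |Real.log (y / bigP D ^ (0.5 : ℝ))| ≤ 0.004 * ell D ^ 9)
    (h2 : |Real.log (bigP D ^ (0.504 : ℝ) / y)| ≤ 0.004 * ell D ^ 9)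
    (h3 : |Real.log (bigP D ^ (0.502 : ℝ) / y)| ≤ 0.004 * ell D ^ 9) :
    ‖-1 + fraky1 c' D j y‖ ≤ 2 := by
  have hb1 := norm_betaJ_le h hα.le hℓ (j + 1)
  have hb2 := norm_betaJ_le h hα.le hℓ (j + 2)
  set A : ℝ := 0.004 * ell D ^ 9 with hA
  have hA0 : 0 ≤ A := by positivity
  have hαA : alpha D * A = 0.004 * π := by rw [hA, ← hαL]; ring
  -- the two pieces of `𝔶₁ⱼ`
  have t1 : ‖(betaJ c' D (j + 1) + betaJ c' D (j + 2)) *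
      (Real.log (y / bigP D ^ (0.5 : ℝ)) : ℂ)‖ ≤ 12 * alpha D * A := by
    rw [norm_mul, Complex.norm_real, Real.norm_eq_abs]
    calc ‖betaJ c' D (j + 1) + betaJ c' D (j + 2)‖ * |Real.log (y / bigP D ^ (0.5 : ℝ))|
        ≤ (6 * alpha D + 6 * alpha D) * A := by
          gcongr
          exact (norm_add_le _ _).trans (add_le_add hb1 hb2)
      _ = 12 * alpha D * A := by ring
  have t2 : ‖betaJ c' D (j + 1) * betaJ c' D (j + 2) / 2 *
      ((Real.log (bigP D ^ (0.504 : ℝ) / y) : ℂ) ^ 2 -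
        2 * (Real.log (bigP D ^ (0.502 : ℝ) / y) : ℂ) ^ 2)‖ ≤ 18 * alpha D ^ 2 * (3 * A ^ 2) := by
    rw [norm_mul, norm_div, norm_mul, Complex.norm_two]
    have hsq : ‖((Real.log (bigP D ^ (0.504 : ℝ) / y) : ℂ) ^ 2 -
        2 * (Real.log (bigP D ^ (0.502 : ℝ) / y) : ℂ) ^ 2)‖ ≤ 3 * A ^ 2 := by
      calc _ ≤ ‖((Real.log (bigP D ^ (0.504 : ℝ) / y) : ℂ)) ^ 2‖ +
            ‖2 * (Real.log (bigP D ^ (0.502 : ℝ) / y) : ℂ) ^ 2‖ := norm_sub_le _ _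
        _ = |Real.log (bigP D ^ (0.504 : ℝ) / y)| ^ 2 +
            2 * |Real.log (bigP D ^ (0.502 : ℝ) / y)| ^ 2 := by
            rw [norm_pow, norm_mul, norm_pow, Complex.norm_real, Complex.norm_real,
              Complex.norm_two, Real.norm_eq_abs, Real.norm_eq_abs]
        _ ≤ A ^ 2 + 2 * A ^ 2 := by
            gcongr
        _ = 3 * A ^ 2 := by ring
    calc ‖betaJ c' D (j + 1)‖ * ‖betaJ c' D (j + 2)‖ / 2 *
          ‖((Real.log (bigP D ^ (0.504 : ℝ) / y) : ℂ) ^ 2 -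
            2 * (Real.log (bigP D ^ (0.502 : ℝ) / y) : ℂ) ^ 2)‖
        ≤ 6 * alpha D * (6 * alpha D) / 2 * (3 * A ^ 2) := by
          gcongr
      _ = 18 * alpha D ^ 2 * (3 * A ^ 2) := by ring
  rw [fraky1]
  calc ‖-1 + ((betaJ c' D (j + 1) + betaJ c' D (j + 2)) *
          (Real.log (y / bigP D ^ (0.5 : ℝ)) : ℂ) +
        betaJ c' D (j + 1) * betaJ c' D (j + 2) / 2 *
          ((Real.log (bigP D ^ (0.504 : ℝ) / y) : ℂ) ^ 2 -
            2 * (Real.log (bigP D ^ (0.502 : ℝ) / y) : ℂ) ^ 2))‖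
      ≤ ‖(-1 : ℂ)‖ + (‖(betaJ c' D (j + 1) + betaJ c' D (j + 2)) *
          (Real.log (y / bigP D ^ (0.5 : ℝ)) : ℂ)‖ +
        ‖betaJ c' D (j + 1) * betaJ c' D (j + 2) / 2 *
          ((Real.log (bigP D ^ (0.504 : ℝ) / y) : ℂ) ^ 2 -
            2 * (Real.log (bigP D ^ (0.502 : ℝ) / y) : ℂ) ^ 2)‖) :=
        (norm_add_le _ _).trans (add_le_add le_rfl (norm_add_le _ _))
    _ ≤ 1 + (12 * alpha D * A + 18 * alpha D ^ 2 * (3 * A ^ 2)) := by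
        rw [norm_neg, norm_one]; gcongr
    _ = 1 + (12 * (0.004 * π) + 54 * (0.004 * π) ^ 2) := by rw [← hαA]; ring
    _ ≤ 2 := by nlinarith [Real.pi_lt_four, Real.pi_pos]

/-- **`|L′(1,χ)| ≤ 4e^{9/2}𝓛²`** for `χ (mod D)` primitive and `𝓛 ≥ 3` (the tree's
`Lemma31.norm_deriv_LFunction_le_near_one` at `w = 1`). [cite: Zhang2022LandauSiegel, §5 Lemma 5.7] -/
theorem norm_deriv_LFunction_one_le [NeZero D] (hD : 3 ≤ ell D) (hχ : χ.IsPrimitive) :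
    ‖deriv χ.LFunction 1‖ ≤ 4 * Real.exp (9 / 2) * ell D ^ 2 := by
  have hL1 : 1 ≤ ell D := by linarith
  have hlog : 3 ≤ Real.log D := by simpa only [ell] using hD
  have hw : ‖(1 : ℂ) - 1‖ ≤ 1 / Real.log D := by
    rw [sub_self, norm_zero]; exact div_nonneg zero_le_one (by linarith)
  have h := Lemma31.norm_deriv_LFunction_le_near_one χ hlog hχ hw
  have h' : ‖deriv χ.LFunction 1‖ ≤ 2 * Real.exp (9 / 2) * (1 + ell D) * ell D := by
    simpa only [ell] using h
  refine h'.trans ?_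
  have h0 : 0 ≤ 2 * Real.exp (9 / 2) := by positivity
  have h1 : (1 + ell D) * ell D ≤ 2 * ell D ^ 2 := by nlinarith
  calc 2 * Real.exp (9 / 2) * (1 + ell D) * ell D = 2 * Real.exp (9 / 2) * ((1 + ell D) * ell D) := by
        ring
    _ ≤ 2 * Real.exp (9 / 2) * (2 * ell D ^ 2) := by gcongr
    _ = 4 * Real.exp (9 / 2) * ell D ^ 2 := by ring

/-! ## Parameter facts for large `D` -/

/-- `P^a = exp(a𝓛⁹)`. [cite: Zhang2022LandauSiegel, §2 (2.6)] -/
theorem bigP_rpow (D : ℕ) (a : ℝ) : bigP D ^ a = Real.exp (a * ell D ^ 9) := by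
  rw [bigP, ← Real.exp_mul, mul_comm]

/-- `log P^a = a𝓛⁹`. [cite: Zhang2022LandauSiegel, §2 (2.6)] -/
theorem log_bigP_rpow (D : ℕ) (a : ℝ) : Real.log (bigP D ^ a) = a * ell D ^ 9 := by
  rw [bigP_rpow, Real.log_exp]

/-- For `𝓛 ≥ 5`: `𝓛^{1.1} ≤ 𝓛²` and `T = exp 𝓛^{1.1} < P^{0.002}`. [cite: Zhang2022LandauSiegel, §2 (2.6), (2.8)] -/
theorem bigT_lt_rpow {D : ℕ} (hL : 5 ≤ ell D) :
    ell D ^ (1.1 : ℝ) ≤ ell D ^ 2 ∧ bigT D < bigP D ^ (0.002 : ℝ) := by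
  have hL1 : (1 : ℝ) ≤ ell D := by linarith
  have h11 : ell D ^ (1.1 : ℝ) ≤ ell D ^ 2 := by
    calc ell D ^ (1.1 : ℝ) ≤ ell D ^ (2 : ℝ) :=
          Real.rpow_le_rpow_of_exponent_le hL1 (by norm_num)
      _ = ell D ^ 2 := by norm_cast
  refine ⟨h11, ?_⟩
  rw [bigT, bigP_rpow, Real.exp_lt_exp]
  have h7 : (500 : ℝ) < ell D ^ 7 := by
    calc (500 : ℝ) < 5 ^ 7 := by norm_num
      _ ≤ ell D ^ 7 := pow_le_pow_left₀ (by norm_num) hL 7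
  have h2 : 0 ≤ ell D ^ 2 := pow_nonneg (by linarith) 2
  have key : ell D ^ 2 < 2e-3 * ell D ^ 9 := by
    have : ell D ^ 9 = ell D ^ 2 * ell D ^ 7 := by ring
    rw [this]
    have h2' : 0 < ell D ^ 2 := pow_pos (by linarith) 2
    nlinarith
  linarith

/-- For `𝓛 ≥ 2`: `P^{0.502} < ⌈PT⁻²⌉` and `P₂ ≤ P^{0.5}`, `1 < T`, `1 < P`.
[cite: Zhang2022LandauSiegel, §2 (2.6)–(2.8), §7 (7.2)] -/
theorem range_sizes {D : ℕ} (hD : 2 ≤ Real.log D) :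
    bigP D ^ (0.502 : ℝ) < (Nsupp D : ℝ) ∧ P2 D ≤ bigP D ^ (0.5 : ℝ) ∧ 1 ≤ bigT D ∧ 1 < bigP D := by
  have hP : 1 < bigP D := by
    rw [bigP]; exact Real.one_lt_exp_iff.mpr (by rw [ell]; positivity)
  have hT : 1 ≤ bigT D := Real.one_le_exp (Real.rpow_nonneg (by rw [ell]; positivity) _)
  refine ⟨?_, ?_, hT, hP⟩
  · calc bigP D ^ (0.502 : ℝ) ≤ P1 D := by
          rw [P1]; exact Real.rpow_le_rpow_of_exponent_le hP.le (by norm_num)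
      _ < bigP D / bigT D ^ 2 := P1_lt_P_div_T_sq D hD
      _ ≤ Nsupp D := Nat.le_ceil _
  · rw [P2]
    exact div_le_self (Real.rpow_nonneg (le_of_lt (lt_trans zero_lt_one hP)) _)
      (one_le_pow₀ hT)

/-! ## Range facts for `P^{0.5} ≤ n < P^{0.502}` -/

/-- For `𝓛 ≥ 5` and `P^{0.5} ≤ n < P^{0.502}`: `x = P₁/n ∈ (T, P)`, `|log x| ≤ 𝓛⁹`, and the three
logarithms of (10.9) are at most `0.004𝓛⁹` in size. [cite: Zhang2022LandauSiegel, §10 p. 57] -/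
theorem range_xfacts {D : ℕ} (hL5 : 5 ≤ ell D) {n : ℕ} (hn1 : 1 ≤ n)
    (hlon : bigP D ^ (0.5 : ℝ) ≤ (n : ℝ)) (hnhi : (n : ℝ) < bigP D ^ (0.502 : ℝ)) :
    bigT D < P1 D / n ∧ P1 D / n < bigP D ∧ |Real.log (P1 D / n)| ≤ ell D ^ 9 ∧
      |Real.log (n / bigP D ^ (0.5 : ℝ))| ≤ 0.004 * ell D ^ 9 ∧
      |Real.log (P1 D / n)| ≤ 0.004 * ell D ^ 9 ∧
      |Real.log (bigP D ^ (0.502 : ℝ) / n)| ≤ 0.004 * ell D ^ 9 := by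
  have hL0 : (0 : ℝ) < ell D := by linarith
  have hn0 : (0 : ℝ) < n := by exact_mod_cast hn1
  have hlo_exp : bigP D ^ (0.5 : ℝ) = Real.exp (0.5 * ell D ^ 9) := bigP_rpow D 0.5
  have hhi_exp : bigP D ^ (0.502 : ℝ) = Real.exp (0.502 * ell D ^ 9) := bigP_rpow D 0.502
  have hP1_exp : P1 D = Real.exp (0.504 * ell D ^ 9) := bigP_rpow D 0.504
  have hlo0 : 0 < bigP D ^ (0.5 : ℝ) := by rw [hlo_exp]; exact Real.exp_pos _
  have hhi0 : 0 < bigP D ^ (0.502 : ℝ) := by rw [hhi_exp]; exact Real.exp_pos _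
  have hP1pos : 0 < P1 D := by rw [hP1_exp]; exact Real.exp_pos _
  have hlogn_lo : 0.5 * ell D ^ 9 ≤ Real.log n := by
    rw [← Real.log_exp (0.5 * ell D ^ 9), ← hlo_exp]; exact Real.log_le_log hlo0 hlon
  have hlogn_hi : Real.log n < 0.502 * ell D ^ 9 := by
    rw [← Real.log_exp (0.502 * ell D ^ 9), ← hhi_exp]; exact Real.log_lt_log hn0 hnhi
  have hlogx : Real.log (P1 D / n) = 0.504 * ell D ^ 9 - Real.log n := by
    rw [Real.log_div hP1pos.ne' hn0.ne', hP1_exp, Real.log_exp]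
  have hL9 : (0 : ℝ) < ell D ^ 9 := by positivity
  obtain ⟨-, hTlt⟩ := bigT_lt_rpow hL5
  refine ⟨?_, ?_, ?_, ?_, ?_, ?_⟩
  · refine lt_of_lt_of_le hTlt ?_
    rw [bigP_rpow, ← Real.exp_log (div_pos hP1pos hn0), Real.exp_le_exp, hlogx]
    linarith
  · rw [← Real.exp_log (div_pos hP1pos hn0), bigP, Real.exp_lt_exp, hlogx]
    linarith
  · rw [hlogx, abs_le]; constructor <;> linarith
  · rw [Real.log_div hn0.ne' hlo0.ne', hlo_exp, Real.log_exp, abs_le]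
    constructor <;> linarith
  · rw [hlogx, abs_le]; constructor <;> linarith
  · rw [Real.log_div hhi0.ne' hn0.ne', hhi_exp, Real.log_exp, abs_le]
    constructor <;> linarith

/-! ## The weight sums over the range and over its windows -/

/-- For `𝓛 ≥ 5` and any set `S` of integers in `[P^{0.5}, P^{0.502})`:
`Σ_{n∈S} (n/φ(n))⁵/n ≤ e^{64}𝓛⁹`. [cite: Zhang2022LandauSiegel, §10 p. 57] -/
theorem weight_sum_full {D : ℕ} (hL5 : 5 ≤ ell D) (S : Finset ℕ)
    (hS : ∀ n ∈ S, 1 ≤ n ∧ bigP D ^ (0.5 : ℝ) ≤ (n : ℝ) ∧ (n : ℝ) < bigP D ^ (0.502 : ℝ)) :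
    ∑ n ∈ S, ((n : ℝ) / Nat.totient n) ^ 5 / n ≤ Real.exp 64 * ell D ^ 9 := by
  have hL1 : (1 : ℝ) ≤ ell D := by linarith
  have h59 : (1953125 : ℝ) ≤ ell D ^ 9 := by
    have h := pow_le_pow_left₀ (by norm_num : (0:ℝ) ≤ 5) hL5 9
    norm_num at h
    exact h
  set lo : ℝ := bigP D ^ (0.5 : ℝ) with hlodef
  set hi : ℝ := bigP D ^ (0.502 : ℝ) with hhidef
  have hlo_exp : lo = Real.exp (0.5 * ell D ^ 9) := bigP_rpow D 0.5
  have hhi_exp : hi = Real.exp (0.502 * ell D ^ 9) := bigP_rpow D 0.502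
  clear_value lo hi
  have hlo0 : 0 < lo := by rw [hlo_exp]; exact Real.exp_pos _
  have hhi0 : 0 < hi := by rw [hhi_exp]; exact Real.exp_pos _
  have hlo2 : (2 : ℝ) ≤ lo := by
    rw [hlo_exp]
    calc (2 : ℝ) ≤ Real.exp 1 := by have := Real.exp_one_gt_d9; linarith
      _ ≤ Real.exp (0.5 * ell D ^ 9) := Real.exp_le_exp.mpr (by linarith)
  have hceil_lo : 2 ≤ ⌈lo⌉₊ := by
    have : (2 : ℝ) ≤ ⌈lo⌉₊ := hlo2.trans (Nat.le_ceil lo)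
    exact_mod_cast this
  have hlohi : lo + 1 ≤ hi := by
    have h2 : (2 : ℝ) ≤ Real.exp (0.002 * ell D ^ 9) := by
      calc (2 : ℝ) ≤ Real.exp 1 := by have := Real.exp_one_gt_d9; linarith
        _ ≤ Real.exp (0.002 * ell D ^ 9) := Real.exp_le_exp.mpr (by linarith)
    have hgap : lo * 2 ≤ hi := by
      calc lo * 2 ≤ lo * Real.exp (0.002 * ell D ^ 9) := mul_le_mul_of_nonneg_left h2 hlo0.le
        _ = hi := by
          rw [hlo_exp, hhi_exp, ← Real.exp_add]
          congr 1
          ring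
    linarith
  obtain ⟨Y₀, hY₀⟩ : ∃ Y₀ : ℕ, Y₀ = ⌈lo⌉₊ - 1 := ⟨_, rfl⟩
  obtain ⟨X₀, hX₀⟩ : ∃ X₀ : ℕ, X₀ = ⌊hi⌋₊ := ⟨_, rfl⟩
  have hY₀1 : 1 ≤ Y₀ := by rw [hY₀]; omega
  have hY₀cast : (Y₀ : ℝ) = (⌈lo⌉₊ : ℝ) - 1 := by
    rw [hY₀, Nat.cast_sub (by omega), Nat.cast_one]
  have hY₀real : lo - 1 ≤ (Y₀ : ℝ) := by
    rw [hY₀cast]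
    exact sub_le_sub_right (Nat.le_ceil lo) 1
  have hX₀le : (X₀ : ℝ) ≤ hi := by rw [hX₀]; exact Nat.floor_le hhi0.le
  have hY₀X₀ : Y₀ ≤ X₀ := by
    have : (Y₀ : ℝ) ≤ X₀ := by
      have hx : hi - 1 ≤ (X₀ : ℝ) := by
        have hX₀cast : (X₀ : ℝ) = ⌊hi⌋₊ := by rw [hX₀]
        have := Nat.lt_floor_add_one hi
        linarith
      have hy : (Y₀ : ℝ) ≤ lo := by
        have := Nat.ceil_lt_add_one hlo0.le
        linarith [hY₀cast]
      linarith
    exact_mod_cast this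
  have hS_sub : S ⊆ Finset.Ioc Y₀ X₀ := by
    intro n hn
    obtain ⟨hn1, hlon, hnhi⟩ := hS n hn
    rw [Finset.mem_Ioc, hY₀, hX₀]
    constructor
    · have : ⌈lo⌉₊ ≤ n := Nat.ceil_le.mpr hlon
      omega
    · exact Nat.le_floor hnhi.le
  have h1 := sum_ratio_pow_div_le 5 hY₀1 hY₀X₀
  have hX₀log : Real.log X₀ ≤ 0.502 * ell D ^ 9 := by
    have hX₀pos : (0 : ℝ) < X₀ := by
      have : (1 : ℝ) ≤ X₀ := by exact_mod_cast le_trans hY₀1 hY₀X₀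
      linarith
    calc Real.log X₀ ≤ Real.log hi := Real.log_le_log hX₀pos hX₀le
      _ = 0.502 * ell D ^ 9 := by rw [hhi_exp, Real.log_exp]
  have hY₀log : 0.5 * ell D ^ 9 - 1 ≤ Real.log Y₀ := by
    have h2 : lo / 2 ≤ Y₀ := by linarith
    have hl : Real.log (lo / 2) = 0.5 * ell D ^ 9 - Real.log 2 := by
      rw [Real.log_div hlo0.ne' (by norm_num), hlo_exp, Real.log_exp]
    have hlog2 : Real.log 2 ≤ 1 := by have := Real.log_two_lt_d9; linarith
    calc 0.5 * ell D ^ 9 - 1 ≤ Real.log (lo / 2) := by rw [hl]; linarith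
      _ ≤ Real.log Y₀ := Real.log_le_log (by linarith) h2
  have h64 : Real.exp (2 ^ (5 + 1)) = Real.exp 64 := by norm_num
  calc ∑ n ∈ S, ((n : ℝ) / Nat.totient n) ^ 5 / n
      ≤ ∑ n ∈ Finset.Ioc Y₀ X₀, ((n : ℝ) / Nat.totient n) ^ 5 / n :=
        Finset.sum_le_sum_of_subset_of_nonneg hS_sub fun n _ _ => by positivity
    _ ≤ Real.exp (2 ^ (5 + 1)) * (1 + Real.log X₀ - Real.log Y₀) := h1
    _ ≤ Real.exp 64 * (2 + 0.002 * ell D ^ 9) := by rw [h64]; gcongr; linarith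
    _ ≤ Real.exp 64 * ell D ^ 9 := by gcongr; linarith

/-- For `𝓛 ≥ 5` and any set `S` of integers `n ∈ [P^{0.5}, P^{0.502})` lying in the two windows
`n ≤ P^{0.5}` or `n > P^{0.502}/T`: `Σ_{n∈S} (n/φ(n))⁵/n ≤ 2e^{64}𝓛²` (the windows have logarithmic
length `≤ 1` and `log T = 𝓛^{1.1} ≤ 𝓛²`). [cite: Zhang2022LandauSiegel, §10 p. 57] -/
theorem weight_sum_window {D : ℕ} (hL5 : 5 ≤ ell D) (S : Finset ℕ)
    (hS : ∀ n ∈ S, 1 ≤ n ∧ bigP D ^ (0.5 : ℝ) ≤ (n : ℝ) ∧ (n : ℝ) < bigP D ^ (0.502 : ℝ) ∧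
      ((n : ℝ) ≤ bigP D ^ (0.5 : ℝ) ∨ bigP D ^ (0.502 : ℝ) / bigT D < (n : ℝ))) :
    ∑ n ∈ S, ((n : ℝ) / Nat.totient n) ^ 5 / n ≤ 2 * Real.exp 64 * ell D ^ 2 := by
  have hL1 : (1 : ℝ) ≤ ell D := by linarith
  have hL0 : (0 : ℝ) < ell D := by linarith
  have h59 : (1953125 : ℝ) ≤ ell D ^ 9 := by
    have h := pow_le_pow_left₀ (by norm_num : (0:ℝ) ≤ 5) hL5 9
    norm_num at h
    exact h
  have h7L : (78125 : ℝ) * ell D ^ 2 ≤ ell D ^ 9 := by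
    have hL7 : (78125 : ℝ) ≤ ell D ^ 7 := by
      have h := pow_le_pow_left₀ (by norm_num : (0:ℝ) ≤ 5) hL5 7
      norm_num at h
      exact h
    calc (78125 : ℝ) * ell D ^ 2 ≤ ell D ^ 7 * ell D ^ 2 := by gcongr
      _ = ell D ^ 9 := by ring
  obtain ⟨h11, -⟩ := bigT_lt_rpow hL5
  set lo : ℝ := bigP D ^ (0.5 : ℝ) with hlodef
  set hi : ℝ := bigP D ^ (0.502 : ℝ) with hhidef
  set T : ℝ := bigT D with hTdef
  have hlo_exp : lo = Real.exp (0.5 * ell D ^ 9) := bigP_rpow D 0.5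
  have hhi_exp : hi = Real.exp (0.502 * ell D ^ 9) := bigP_rpow D 0.502
  have hT_exp : T = Real.exp (ell D ^ (1.1 : ℝ)) := rfl
  clear_value lo hi T
  have hlo0 : 0 < lo := by rw [hlo_exp]; exact Real.exp_pos _
  have hhi0 : 0 < hi := by rw [hhi_exp]; exact Real.exp_pos _
  have hT0 : 0 < T := by rw [hT_exp]; exact Real.exp_pos _
  have hT1 : 1 ≤ T := by rw [hT_exp]; exact Real.one_le_exp (by positivity)
  have hlogT : Real.log T = ell D ^ (1.1 : ℝ) := by rw [hT_exp, Real.log_exp]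
  have hlo2 : (2 : ℝ) ≤ lo := by
    rw [hlo_exp]
    calc (2 : ℝ) ≤ Real.exp 1 := by have := Real.exp_one_gt_d9; linarith
      _ ≤ Real.exp (0.5 * ell D ^ 9) := Real.exp_le_exp.mpr (by linarith)
  have hceil_lo : 2 ≤ ⌈lo⌉₊ := by
    have : (2 : ℝ) ≤ ⌈lo⌉₊ := hlo2.trans (Nat.le_ceil lo)
    exact_mod_cast this
  have hhiT2 : 2 ≤ hi / T := by
    rw [le_div_iff₀ hT0, hhi_exp, hT_exp]
    have h2 : (2 : ℝ) * Real.exp (ell D ^ (1.1 : ℝ)) ≤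
        Real.exp 1 * Real.exp (ell D ^ (1.1 : ℝ)) := by
      gcongr; have := Real.exp_one_gt_d9; linarith
    refine h2.trans ?_
    rw [← Real.exp_add, Real.exp_le_exp]
    linarith
  set A : Finset ℕ := Finset.Ioc (⌈lo⌉₊ - 1) ⌈lo⌉₊ with hA
  set B : Finset ℕ := Finset.Ioc ⌊hi / T⌋₊ ⌊hi⌋₊ with hB
  have hsub : S ⊆ A ∪ B := by
    intro n hn
    obtain ⟨hn1, hlon, hnhi, hwin⟩ := hS n hn
    rw [Finset.mem_union]
    rcases hwin with h | h
    · left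
      rw [hA, Finset.mem_Ioc]
      have hceq : ⌈lo⌉₊ ≤ n := Nat.ceil_le.mpr hlon
      have hle : n ≤ ⌈lo⌉₊ := by
        have : (n : ℝ) ≤ ⌈lo⌉₊ := h.trans (Nat.le_ceil lo)
        exact_mod_cast this
      omega
    · right
      rw [hB, Finset.mem_Ioc]
      exact ⟨(Nat.floor_lt (div_pos hhi0 hT0).le).mpr h, Nat.le_floor hnhi.le⟩
  have hApos : 1 ≤ ⌈lo⌉₊ - 1 := by omega
  have hA_le : ∑ n ∈ A, ((n : ℝ) / Nat.totient n) ^ 5 / n ≤ Real.exp 64 * 2 := by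
    have h1 := sum_ratio_pow_div_le 5 hApos (Nat.sub_le ⌈lo⌉₊ 1)
    have h64 : Real.exp (2 ^ (5 + 1)) = Real.exp 64 := by norm_num
    rw [h64] at h1
    refine h1.trans ?_
    gcongr
    have hm : (2 : ℝ) ≤ (⌈lo⌉₊ : ℝ) := by exact_mod_cast hceil_lo
    have hcast : ((⌈lo⌉₊ - 1 : ℕ) : ℝ) = (⌈lo⌉₊ : ℝ) - 1 := by
      rw [Nat.cast_sub (by omega), Nat.cast_one]
    have hq : Real.log (⌈lo⌉₊ : ℝ) - Real.log ((⌈lo⌉₊ : ℝ) - 1) ≤ 1 := by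
      rw [← Real.log_div (by linarith) (by linarith)]
      have h0 : 0 < (⌈lo⌉₊ : ℝ) / ((⌈lo⌉₊ : ℝ) - 1) := by apply div_pos <;> linarith
      have := Real.log_le_sub_one_of_pos h0
      have hm1 : (⌈lo⌉₊ : ℝ) - 1 ≠ 0 := by linarith
      have hq' : (⌈lo⌉₊ : ℝ) / ((⌈lo⌉₊ : ℝ) - 1) - 1 = 1 / ((⌈lo⌉₊ : ℝ) - 1) := by
        field_simp; ring
      rw [hq'] at this
      have : 1 / ((⌈lo⌉₊ : ℝ) - 1) ≤ 1 := by
        rw [div_le_one (by linarith)]; linarith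
      linarith
    have hlogeq : Real.log (((⌈lo⌉₊ - 1 : ℕ) : ℝ)) = Real.log ((⌈lo⌉₊ : ℝ) - 1) := by
      rw [hcast]
    linarith [hlogeq, hq]
  have hB_le : ∑ n ∈ B, ((n : ℝ) / Nat.totient n) ^ 5 / n ≤ Real.exp 64 * (2 + ell D ^ 2) := by
    have hBpos : 1 ≤ ⌊hi / T⌋₊ := by
      have : (1 : ℝ) ≤ hi / T := by linarith
      exact Nat.le_floor (by exact_mod_cast this)
    have hBle : ⌊hi / T⌋₊ ≤ ⌊hi⌋₊ := Nat.floor_mono (div_le_self hhi0.le hT1)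
    have h1 := sum_ratio_pow_div_le 5 hBpos hBle
    have h64 : Real.exp (2 ^ (5 + 1)) = Real.exp 64 := by norm_num
    rw [h64] at h1
    refine h1.trans ?_
    gcongr
    have hX : Real.log (⌊hi⌋₊ : ℝ) ≤ 0.502 * ell D ^ 9 := by
      have hpos : (0 : ℝ) < ⌊hi⌋₊ := by
        have : (1 : ℝ) ≤ ⌊hi⌋₊ := by exact_mod_cast le_trans hBpos hBle
        linarith
      calc Real.log (⌊hi⌋₊ : ℝ) ≤ Real.log hi := Real.log_le_log hpos (Nat.floor_le hhi0.le)
        _ = 0.502 * ell D ^ 9 := by rw [hhi_exp, Real.log_exp]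
    have hY : 0.502 * ell D ^ 9 - ell D ^ (1.1 : ℝ) - 1 ≤ Real.log (⌊hi / T⌋₊ : ℝ) := by
      have hpos : (0 : ℝ) < hi / T / 2 := by positivity
      have h2 : hi / T / 2 ≤ ⌊hi / T⌋₊ := by
        have := Nat.lt_floor_add_one (hi / T); linarith
      have hlog : Real.log (hi / T / 2) = 0.502 * ell D ^ 9 - ell D ^ (1.1 : ℝ) - Real.log 2 := by
        rw [Real.log_div (by positivity) (by norm_num), Real.log_div hhi0.ne' hT0.ne',
          hhi_exp, Real.log_exp, hlogT]
      have hlog2 : Real.log 2 ≤ 1 := by have := Real.log_two_lt_d9; linarith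
      calc 0.502 * ell D ^ 9 - ell D ^ (1.1 : ℝ) - 1 ≤ Real.log (hi / T / 2) := by
            rw [hlog]; linarith
        _ ≤ Real.log (⌊hi / T⌋₊ : ℝ) := Real.log_le_log hpos h2
    linarith
  calc ∑ n ∈ S, ((n : ℝ) / Nat.totient n) ^ 5 / n
      ≤ ∑ n ∈ A ∪ B, ((n : ℝ) / Nat.totient n) ^ 5 / n :=
        Finset.sum_le_sum_of_subset_of_nonneg hsub fun n _ _ => by positivity
    _ ≤ ∑ n ∈ A, ((n : ℝ) / Nat.totient n) ^ 5 / n + ∑ n ∈ B, ((n : ℝ) / Nat.totient n) ^ 5 / n := by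
        rw [← Finset.sum_union_inter]
        have : 0 ≤ ∑ n ∈ A ∩ B, ((n : ℝ) / Nat.totient n) ^ 5 / n :=
          Finset.sum_nonneg fun n _ => by positivity
        linarith
    _ ≤ Real.exp 64 * 2 + Real.exp 64 * (2 + ell D ^ 2) := add_le_add hA_le hB_le
    _ = Real.exp 64 * (4 + ell D ^ 2) := by ring
    _ ≤ Real.exp 64 * (2 * ell D ^ 2) := by gcongr; nlinarith
    _ = 2 * Real.exp 64 * ell D ^ 2 := by ring

/-! ## The constants -/

/-- The sizes of the error coefficients of the assembly, for `𝓛 ≥ 5`: with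
`B_M = 128e^{9/2}𝓛²/(0.504𝓛⁹)`, `e_M = |C₂|𝓛⁻⁶/(0.504𝓛⁹)`, `e_N = |C₁|𝓛⁻¹⁵`, `e_W = |C₁|𝓛⁻⁷` and
`|c₀| ≤ 2000e^{9/2}𝓛⁻⁷`: the main coefficient is `≤ K₁𝓛⁻²²`, the window coefficient `≤ K₂𝓛⁻¹⁴`.
[cite: Zhang2022LandauSiegel, §10 p. 57] -/
theorem consts_bound {L C₁ C₂ c0 : ℝ} (hL5 : 5 ≤ L) (hc0 : 0 ≤ c0)
    (hc0le : c0 ≤ 2000 * Real.exp (9 / 2) * (L ^ 7)⁻¹) :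
    (4 * Real.exp (9 / 2) * L ^ 2 * 32 / (0.504 * L ^ 9) + |C₂| * (L ^ 6)⁻¹ / (0.504 * L ^ 9)) *
          (|C₁| * (L ^ 15)⁻¹) + |C₂| * (L ^ 6)⁻¹ / (0.504 * L ^ 9) * c0 * 2 ≤
        ((254 * Real.exp (9 / 2) + 2 * |C₂|) * |C₁| + 8000 * Real.exp (9 / 2) * |C₂|) * (L ^ 22)⁻¹ ∧
      (4 * Real.exp (9 / 2) * L ^ 2 * 32 / (0.504 * L ^ 9) + |C₂| * (L ^ 6)⁻¹ / (0.504 * L ^ 9)) *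
          (|C₁| * (L ^ 7)⁻¹) + 4 * Real.exp (9 / 2) * L ^ 2 * 32 / (0.504 * L ^ 9) * c0 * 2 ≤
        ((254 * Real.exp (9 / 2) + 2 * |C₂|) * |C₁| +
          1016000 * (Real.exp (9 / 2) * Real.exp (9 / 2))) * (L ^ 14)⁻¹ := by
  have hL1 : (1 : ℝ) ≤ L := by linarith
  have hL0 : (0 : ℝ) < L := by linarith
  set BM : ℝ := 4 * Real.exp (9 / 2) * L ^ 2 * 32 / (0.504 * L ^ 9) with hBM
  set eM : ℝ := |C₂| * (L ^ 6)⁻¹ / (0.504 * L ^ 9) with heM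
  have hl15_le_l7 : (L ^ 15)⁻¹ ≤ (L ^ 7)⁻¹ := by
    rw [inv_le_inv₀ (by positivity) (by positivity)]
    exact pow_le_pow_right₀ hL1 (by norm_num)
  have hBM' : BM ≤ 254 * Real.exp (9 / 2) * (L ^ 7)⁻¹ := by
    rw [hBM, div_eq_mul_inv]
    have : (4 * Real.exp (9 / 2) * L ^ 2 * 32) * (0.504 * L ^ 9)⁻¹ =
        (128 / 0.504) * Real.exp (9 / 2) * (L ^ 7)⁻¹ := by
      field_simp
      norm_num
    rw [this]
    have h254 : (128 : ℝ) / 0.504 ≤ 254 := by norm_num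
    exact mul_le_mul_of_nonneg_right (mul_le_mul_of_nonneg_right h254 (by positivity))
      (by positivity)
  have hBM0 : 0 ≤ BM := by rw [hBM]; positivity
  have heM' : eM ≤ 2 * |C₂| * (L ^ 15)⁻¹ := by
    rw [heM]
    have : |C₂| * (L ^ 6)⁻¹ / (0.504 * L ^ 9) = (1 / 0.504) * |C₂| * (L ^ 15)⁻¹ := by
      field_simp
    rw [this]
    have h2 : (1 : ℝ) / 0.504 ≤ 2 := by norm_num
    exact mul_le_mul_of_nonneg_right (mul_le_mul_of_nonneg_right h2 (abs_nonneg _)) (by positivity)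
  have heM0 : 0 ≤ eM := by rw [heM]; positivity
  have hsum1 : BM + eM ≤ (254 * Real.exp (9 / 2) + 2 * |C₂|) * (L ^ 7)⁻¹ := by
    calc BM + eM ≤ 254 * Real.exp (9 / 2) * (L ^ 7)⁻¹ + 2 * |C₂| * (L ^ 15)⁻¹ := add_le_add hBM' heM'
      _ ≤ 254 * Real.exp (9 / 2) * (L ^ 7)⁻¹ + 2 * |C₂| * (L ^ 7)⁻¹ := by gcongr
      _ = (254 * Real.exp (9 / 2) + 2 * |C₂|) * (L ^ 7)⁻¹ := by ring
  have hprod22 : (L ^ 7)⁻¹ * (L ^ 15)⁻¹ = (L ^ 22)⁻¹ := by rw [← mul_inv, ← pow_add]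
  have hprod14 : (L ^ 7)⁻¹ * (L ^ 7)⁻¹ = (L ^ 14)⁻¹ := by rw [← mul_inv, ← pow_add]
  have hsum0 : 0 ≤ BM + eM := add_nonneg hBM0 heM0
  constructor
  · have t1 : (BM + eM) * (|C₁| * (L ^ 15)⁻¹) ≤
        (254 * Real.exp (9 / 2) + 2 * |C₂|) * |C₁| * (L ^ 22)⁻¹ := by
      calc (BM + eM) * (|C₁| * (L ^ 15)⁻¹)
          ≤ ((254 * Real.exp (9 / 2) + 2 * |C₂|) * (L ^ 7)⁻¹) * (|C₁| * (L ^ 15)⁻¹) :=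
            mul_le_mul_of_nonneg_right hsum1 (by positivity)
        _ = (254 * Real.exp (9 / 2) + 2 * |C₂|) * |C₁| * ((L ^ 7)⁻¹ * (L ^ 15)⁻¹) := by ring
        _ = _ := by rw [hprod22]
    have t2 : eM * c0 * 2 ≤ 8000 * Real.exp (9 / 2) * |C₂| * (L ^ 22)⁻¹ := by
      calc eM * c0 * 2 ≤ (2 * |C₂| * (L ^ 15)⁻¹) * (2000 * Real.exp (9 / 2) * (L ^ 7)⁻¹) * 2 := by
            gcongr
        _ = 8000 * Real.exp (9 / 2) * |C₂| * ((L ^ 7)⁻¹ * (L ^ 15)⁻¹) := by ring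
        _ = _ := by rw [hprod22]
    calc (BM + eM) * (|C₁| * (L ^ 15)⁻¹) + eM * c0 * 2
        ≤ (254 * Real.exp (9 / 2) + 2 * |C₂|) * |C₁| * (L ^ 22)⁻¹ +
          8000 * Real.exp (9 / 2) * |C₂| * (L ^ 22)⁻¹ := add_le_add t1 t2
      _ = _ := by ring
  · have t1 : (BM + eM) * (|C₁| * (L ^ 7)⁻¹) ≤
        (254 * Real.exp (9 / 2) + 2 * |C₂|) * |C₁| * (L ^ 14)⁻¹ := by
      calc (BM + eM) * (|C₁| * (L ^ 7)⁻¹)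
          ≤ ((254 * Real.exp (9 / 2) + 2 * |C₂|) * (L ^ 7)⁻¹) * (|C₁| * (L ^ 7)⁻¹) :=
            mul_le_mul_of_nonneg_right hsum1 (by positivity)
        _ = (254 * Real.exp (9 / 2) + 2 * |C₂|) * |C₁| * ((L ^ 7)⁻¹ * (L ^ 7)⁻¹) := by ring
        _ = _ := by rw [hprod14]
    have t2 : BM * c0 * 2 ≤ 1016000 * (Real.exp (9 / 2) * Real.exp (9 / 2)) * (L ^ 14)⁻¹ := by
      calc BM * c0 * 2 ≤ (254 * Real.exp (9 / 2) * (L ^ 7)⁻¹) *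
            (2000 * Real.exp (9 / 2) * (L ^ 7)⁻¹) * 2 := by gcongr
        _ = 1016000 * (Real.exp (9 / 2) * Real.exp (9 / 2)) * ((L ^ 7)⁻¹ * (L ^ 7)⁻¹) := by ring
        _ = _ := by rw [hprod14]
    calc (BM + eM) * (|C₁| * (L ^ 7)⁻¹) + BM * c0 * 2
        ≤ (254 * Real.exp (9 / 2) + 2 * |C₂|) * |C₁| * (L ^ 14)⁻¹ +
          1016000 * (Real.exp (9 / 2) * Real.exp (9 / 2)) * (L ^ 14)⁻¹ := add_le_add t1 t2
      _ = _ := by ring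

/-- The final numeric step: `W₁K₁𝓛⁻²² + W₂K₂𝓛⁻¹⁴ ≤ επ𝓛⁻⁹` for `W₁ ≤ e^{64}𝓛⁹`, `W₂ ≤ 2e^{64}𝓛²`,
once `𝓛 ≥ (e^{64}K₁ + 2e^{64}K₂)/(επ)` (and `𝓛 ≥ 1`). [cite: Zhang2022LandauSiegel, §10 p. 57] -/
theorem final_bound {L ε K₁ K₂ W₁ W₂ A₁ A₂ : ℝ} (hL1 : 1 ≤ L) (hε : 0 < ε) (hK₁ : 0 ≤ K₁)
    (hK₂ : 0 ≤ K₂) (hA₁0 : 0 ≤ A₁) (hA₂0 : 0 ≤ A₂)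
    (hW₁ : W₁ ≤ Real.exp 64 * L ^ 9) (hW₂ : W₂ ≤ 2 * Real.exp 64 * L ^ 2)
    (hA₁ : A₁ ≤ K₁ * (L ^ 22)⁻¹) (hA₂ : A₂ ≤ K₂ * (L ^ 14)⁻¹)
    (hLX : (Real.exp 64 * K₁ + 2 * Real.exp 64 * K₂) / (ε * π) ≤ L) :
    W₁ * A₁ + W₂ * A₂ ≤ ε * (π / L ^ 9) := by
  have hL0 : 0 < L := by linarith
  set K : ℝ := Real.exp 64 * K₁ + 2 * Real.exp 64 * K₂ with hK
  have hK0 : 0 ≤ K := by positivity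
  have step1 : W₁ * A₁ + W₂ * A₂ ≤
      (Real.exp 64 * L ^ 9) * (K₁ * (L ^ 22)⁻¹) + (2 * Real.exp 64 * L ^ 2) * (K₂ * (L ^ 14)⁻¹) := by
    gcongr
  have e1 : Real.exp 64 * L ^ 9 * (K₁ * (L ^ 22)⁻¹) = Real.exp 64 * K₁ * (L ^ 13)⁻¹ := by
    field_simp
  have e2 : 2 * Real.exp 64 * L ^ 2 * (K₂ * (L ^ 14)⁻¹) = 2 * Real.exp 64 * K₂ * (L ^ 12)⁻¹ := by
    field_simp
  have h1213 : (L ^ 13)⁻¹ ≤ (L ^ 12)⁻¹ := by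
    rw [inv_le_inv₀ (by positivity) (by positivity)]
    exact pow_le_pow_right₀ hL1 (by norm_num)
  have step2 : Real.exp 64 * K₁ * (L ^ 13)⁻¹ + 2 * Real.exp 64 * K₂ * (L ^ 12)⁻¹ ≤
      K * (L ^ 12)⁻¹ := by
    rw [hK, add_mul]
    have : Real.exp 64 * K₁ * (L ^ 13)⁻¹ ≤ Real.exp 64 * K₁ * (L ^ 12)⁻¹ :=
      mul_le_mul_of_nonneg_left h1213 (by positivity)
    linarith
  have hKle' : K ≤ ε * π * L := by
    have := hLX
    rwa [div_le_iff₀ (by positivity), mul_comm] at this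
  have hL3 : L ≤ L ^ 3 := by
    calc L = L ^ 1 := (pow_one _).symm
      _ ≤ L ^ 3 := pow_le_pow_right₀ hL1 (by norm_num)
  have step3 : K * (L ^ 12)⁻¹ ≤ ε * (π / L ^ 9) := by
    rw [show ε * (π / L ^ 9) = (ε * π * L ^ 3) * (L ^ 12)⁻¹ by field_simp]
    gcongr
    exact hKle'.trans (mul_le_mul_of_nonneg_left hL3 (by positivity))
  calc W₁ * A₁ + W₂ * A₂ ≤ _ := step1
    _ = Real.exp 64 * K₁ * (L ^ 13)⁻¹ + 2 * Real.exp 64 * K₂ * (L ^ 12)⁻¹ := by rw [e1, e2]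
    _ ≤ K * (L ^ 12)⁻¹ := step2
    _ ≤ ε * (π / L ^ 9) := step3

/-! ## The `(d,r)` sum re-indexed, and the printed main term -/

/-- The `(d,r)`-sum over `lo ≤ dr < hi` (`hi < ⌈PT⁻²⌉`) re-indexed by `n = dr`, with the weight
`|χ(d)||μχ(r)|λ₀ⱼ(dr)/(drφ(r))` written as `[r sqfree]·(|χ(n)|λ₀ⱼ(n)/n)/φ(r)`.
[cite: Zhang2022LandauSiegel, §10 p. 57] -/
theorem drSum_reindex [NeZero D] (j : ℕ) (M : ℕ → ℂ) (N : ℕ → ℕ → ℂ) {lo hi : ℝ}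
    (hhi : hi < (Nsupp D : ℝ)) :
    Sec10B.drSum c' χ j M N lo hi =
      ∑ n ∈ (Finset.Ico 1 (Nsupp D)).filter (fun n : ℕ => lo ≤ (n : ℝ) ∧ (n : ℝ) < hi),
        ∑ r ∈ n.divisors, (if Squarefree r then
          ((‖χ (n : ZMod D)‖ : ℂ) * lamZero c' D j n / (n : ℂ)) / (Nat.totient r : ℂ) * M n *
            N (n / r) r else 0) := by
  classical
  have hp_lt : ∀ n : ℕ, (lo ≤ (n : ℝ) ∧ (n : ℝ) < hi) → n < Nsupp D := fun n hn => by
    exact_mod_cast (lt_trans hn.2 hhi : (n : ℝ) < Nsupp D)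
  rw [Sec10B.drSum]
  have step := sum_box_ite_eq_sum_divisors (Nsupp D) (fun n : ℕ => lo ≤ (n : ℝ) ∧ (n : ℝ) < hi)
    hp_lt (fun d r => Sec10B.drWeight c' χ j d r * M (d * r) * N d r)
  rw [step]
  refine Finset.sum_congr rfl fun n hn => Finset.sum_congr rfl fun r hr => ?_
  have hrn : r ∣ n := (Nat.mem_divisors.mp hr).1
  have hnr : n / r * r = n := Nat.div_mul_cancel hrn
  rw [Sec10B.drWeight, norm_chi_mul_norm_moebius_chi, hnr]
  split_ifs with hsq
  · have hn0 : (n : ℂ) ≠ 0 := by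
      have : 1 ≤ n := (Finset.mem_Ico.mp (Finset.mem_filter.mp hn).1).1
      exact_mod_cast (show n ≠ 0 by omega)
    have hφ0 : (Nat.totient r : ℂ) ≠ 0 := by
      have : 0 < r := Nat.pos_of_mem_divisors hr
      exact_mod_cast (Nat.totient_pos.mpr this).ne'
    field_simp
  · simp

/-- The collapsed main term of the assembly IS the printed `n`-sum of (10.12)'s second range:
`(500L′²/(0.504 log²P))Σ_{P^{0.5}≤n<P^{0.502}}|χ(n)|λ₀ⱼ(n)φ(n)⁻¹𝔣_{j6}(P^{0.504}/n)(−1+𝔶₁ⱼ(n))`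
equals `Σ_n (|χ(n)|λ₀ⱼ(n)/n)(n/φ(n))·(L′𝔣_{j6}(P₁/n)/log P₁)·(500L′/log P)·(−1+𝔶₁ⱼ(n))`
(`log P₁ = 0.504 log P`). [cite: Zhang2022LandauSiegel, §10 p. 57] -/
theorem mainTerm_eq [NeZero D] (hD : 2 ≤ Real.log D) (j : ℕ) :
    500 * deriv χ.LFunction 1 ^ 2 / (0.504 * Sec10B.logP D ^ 2) *
        Sec10B.nAvg c' χ j (bigP D ^ (0.5 : ℝ)) (bigP D ^ (0.502 : ℝ))
          (fun n => frakfW c' D j 6 (bigP D ^ (0.504 : ℝ) / n) * (-1 + fraky1 c' D j n)) =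
      ∑ n ∈ (Finset.Ico 1 (Nsupp D)).filter
          (fun n : ℕ => bigP D ^ (0.5 : ℝ) ≤ (n : ℝ) ∧ (n : ℝ) < bigP D ^ (0.502 : ℝ)),
        ((‖χ (n : ZMod D)‖ : ℂ) * lamZero c' D j n / (n : ℂ)) * ((n : ℂ) / (Nat.totient n : ℂ)) *
          (deriv χ.LFunction 1 * frakfW c' D j 6 (P1 D / n) / (Real.log (P1 D) : ℂ) *
            (500 * deriv χ.LFunction 1 / (Real.log (bigP D) : ℂ)) * (-1 + fraky1 c' D j n)) := by
  classical
  obtain ⟨hhiN, -, -, -⟩ := range_sizes (D := D) hD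
  have hL0 : 0 < ell D := by rw [ell]; linarith
  have hidx : (Finset.Ico 1 ⌈bigP D ^ (0.502 : ℝ)⌉₊).filter (fun n : ℕ => bigP D ^ (0.5 : ℝ) ≤ (n : ℝ)) =
      (Finset.Ico 1 (Nsupp D)).filter
        (fun n : ℕ => bigP D ^ (0.5 : ℝ) ≤ (n : ℝ) ∧ (n : ℝ) < bigP D ^ (0.502 : ℝ)) := by
    ext n
    rw [Finset.mem_filter, Finset.mem_filter, Finset.mem_Ico, Finset.mem_Ico, Nat.lt_ceil]
    constructor
    · rintro ⟨⟨h1, h2⟩, h3⟩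
      exact ⟨⟨h1, by exact_mod_cast (lt_trans h2 hhiN : (n : ℝ) < Nsupp D)⟩, h3, h2⟩
    · rintro ⟨⟨h1, -⟩, h3, h2⟩
      exact ⟨⟨h1, h2⟩, h3⟩
  rw [Sec10B.nAvg, hidx, Finset.mul_sum]
  refine Finset.sum_congr rfl fun n hn => ?_
  have hn0 : (n : ℂ) ≠ 0 := by
    have : 1 ≤ n := (Finset.mem_Ico.mp (Finset.mem_filter.mp hn).1).1
    exact_mod_cast (show n ≠ 0 by omega)
  have hφ0 : (Nat.totient n : ℂ) ≠ 0 := by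
    have : 1 ≤ n := (Finset.mem_Ico.mp (Finset.mem_filter.mp hn).1).1
    exact_mod_cast (Nat.totient_pos.mpr (by omega)).ne'
  have hl0 : (ell D : ℂ) ≠ 0 := by exact_mod_cast hL0.ne'
  have hlogP1C : (Real.log (P1 D) : ℂ) = 0.504 * (ell D : ℂ) ^ 9 := by
    rw [P1, log_bigP_rpow]; push_cast; ring
  have hlogPC : (Sec10B.logP D : ℂ) = (ell D : ℂ) ^ 9 := by
    rw [Sec10B.logP, log_bigP]; push_cast; ring
  have hlogbigP : (Real.log (bigP D) : ℂ) = (ell D : ℂ) ^ 9 := by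
    rw [log_bigP]; push_cast; ring
  simp only [P1]
  rw [hlogPC, show (Real.log (bigP D ^ (0.504 : ℝ)) : ℂ) = 0.504 * (ell D : ℂ) ^ 9 by
    rw [← P1, hlogP1C]]
  field_simp

/-! ## The main step: `Z22:§10.u037`, first line -/

/-- **`Z22:§10.u037` (first line) DISCHARGED from its cited inputs**: the typed display
`Typed.Sec10B.Eq1037a c′` — "the sum over `P^{0.5} ≤ dr < P^{0.502}` [of `Sⱼ(𝐚₁₁,𝐚₁₃)`] is equal to
`(500L′(1,χ)²/(0.504 log²P)) Σ_{P^{0.5}≤n<P^{0.502}} |χ(n)|λ₀ⱼ(n)φ(n)⁻¹𝔣_{j6}(P^{0.504}/n)(−1 + 𝔶₁ⱼ(n))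
+ o(α)`" (§10 p. 57, tex L2932) — FOLLOWS (kernel-checked) from the leaf `Skeleton.Lemma102 c′`
(Lemma 10.2: (10.9) and the windows (10.11)), the node `Skeleton.Lemma82 c′` (Lemma 8.2, a tree
theorem for `c′ ≥ 0`) and the typed identity `Section8cStatements.Eq810` ((8.10)), all CLAIMS of the
manuscript taken as hypotheses; the error is `≪ 𝓛⁻¹² = o(𝓛⁻⁹) = o(α)`.
[cite: Zhang2022LandauSiegel, §10 p. 57] -/
theorem eq1037a_of [NeZero D] (h102 : Lemma102 c') (h82 : Lemma82 c')
    (h810 : Section8cStatements.Eq810) : Sec10B.Eq1037a c' := by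
  classical
  intro ε hε
  obtain ⟨C₁, H₁⟩ := h102
  obtain ⟨C₂, H₂⟩ := h82
  -- the final constants
  set K₁ : ℝ := (254 * Real.exp (9 / 2) + 2 * |C₂|) * |C₁| + 8000 * Real.exp (9 / 2) * |C₂|
    with hK₁
  set K₂ : ℝ := (254 * Real.exp (9 / 2) + 2 * |C₂|) * |C₁| +
    1016000 * (Real.exp (9 / 2) * Real.exp (9 / 2)) with hK₂
  have hK₁0 : 0 ≤ K₁ := by positivity
  have hK₂0 : 0 ≤ K₂ := by positivity
  set X : ℝ := (Real.exp 64 * K₁ + 2 * Real.exp 64 * K₂) / (ε * π) + 5 with hX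
  obtain ⟨D₀, hH⟩ := H₁.and H₂
  refine ⟨max D₀ (max ⌈Real.exp (π * |c'| + 5)⌉₊ ⌈Real.exp X⌉₊), fun D _ χ hD hq hp hA j hj => ?_⟩
  have hD₀ : D₀ ≤ D := le_trans (le_max_left _ _) hD
  have hDc : ⌈Real.exp (π * |c'| + 5)⌉₊ ≤ D :=
    le_trans (le_trans (le_max_left _ _) (le_max_right _ _)) hD
  have hDX : ⌈Real.exp X⌉₊ ≤ D := le_trans (le_trans (le_max_right _ _) (le_max_right _ _)) hD
  obtain ⟨hL5, hα, hcαL⟩ := large_D hDc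
  have hLX : X ≤ ell D := by
    have h : Real.exp X ≤ D := le_trans (Nat.le_ceil _) (by exact_mod_cast hDX)
    rw [ell]; exact (Real.le_log_iff_exp_le (lt_of_lt_of_le (Real.exp_pos _) h)).mpr h
  obtain ⟨H₁', H₂'⟩ := hH D χ hD₀ hq hp
  replace H₁' := H₁' hA j hj
  replace H₂' := H₂' hA j hj 6 (by simp)
  ------------------------------------------------------------------
  -- parameters
  ------------------------------------------------------------------
  have hlog2 : 2 ≤ Real.log D := by have h := hL5; rw [ell] at h; linarith
  have hL1 : (1 : ℝ) ≤ ell D := by linarith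
  have hL0 : (0 : ℝ) < ell D := by linarith
  have hαeq : alpha D = π / ell D ^ 9 := by rw [alpha, bigP, Real.log_exp]
  have hαL : alpha D * ell D ^ 9 = π := by rw [hαeq]; field_simp
  obtain ⟨hhiN, hP2lo, hT1, hP1⟩ := range_sizes (D := D) hlog2
  have hMT0 := mainTerm_eq c' χ hlog2 j
  have hreidx0 := drSum_reindex c' χ j (Sec10B.mSum11 c' χ j) (Sec10B.nSum13 c' χ j)
    (lo := bigP D ^ (0.5 : ℝ)) hhiN
  set P : ℝ := bigP D with hPdef
  set lo : ℝ := bigP D ^ (0.5 : ℝ) with hlodef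
  set hi : ℝ := bigP D ^ (0.502 : ℝ) with hhidef
  set T : ℝ := bigT D with hTdef
  have hlo_exp : lo = Real.exp (0.5 * ell D ^ 9) := bigP_rpow D 0.5
  have hP1_exp : P1 D = Real.exp (0.504 * ell D ^ 9) := bigP_rpow D 0.504
  have hlogP : Real.log P = ell D ^ 9 := log_bigP D
  have hT_exp : T = Real.exp (ell D ^ (1.1 : ℝ)) := rfl
  set M : ℕ → ℂ := Sec10B.mSum11 c' χ j with hMdef
  set N : ℕ → ℕ → ℂ := Sec10B.nSum13 c' χ j with hNdef
  set S : Finset ℕ := (Finset.Ico 1 (Nsupp D)).filter (fun n : ℕ => lo ≤ (n : ℝ) ∧ (n : ℝ) < hi)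
    with hSdef
  clear_value P lo hi T M N S
  have hP0 : 0 < P := lt_trans zero_lt_one hP1
  have hlo0 : 0 < lo := by rw [hlo_exp]; exact Real.exp_pos _
  have hT0 : 0 < T := lt_of_lt_of_le zero_lt_one hT1
  have hT1' : 1 < T := by
    rw [hT_exp]; exact Real.one_lt_exp_iff.mpr (Real.rpow_pos_of_pos hL0 _)
  have hP1pos : 0 < P1 D := by rw [hP1_exp]; exact Real.exp_pos _
  have hlogP1 : Real.log (P1 D) = 0.504 * ell D ^ 9 := by rw [hP1_exp, Real.log_exp]
  have hlogP1pos : 0 < Real.log (P1 D) := by rw [hlogP1]; positivity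
  -- the objects of the abstract assembly (opaque names with defining equations)
  obtain ⟨a, hadef⟩ : ∃ a : ℕ → ℂ, a = fun n : ℕ => (‖χ (n : ZMod D)‖ : ℂ) * lamZero c' D j n / (n : ℂ) :=
    ⟨_, rfl⟩
  obtain ⟨M₀, hM₀def⟩ : ∃ M₀ : ℕ → ℂ, M₀ = fun n : ℕ => deriv χ.LFunction 1 *
      frakfW c' D j 6 (P1 D / n) / (Real.log (P1 D) : ℂ) := ⟨_, rfl⟩
  obtain ⟨G, hGdef⟩ : ∃ G : ℕ → ℂ, G = fun n : ℕ => -1 + fraky1 c' D j n := ⟨_, rfl⟩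
  obtain ⟨c₀, hc₀def⟩ : ∃ c₀ : ℂ, c₀ = 500 * deriv χ.LFunction 1 / (Real.log P : ℂ) := ⟨_, rfl⟩
  obtain ⟨main, hmaindef⟩ : ∃ main : ℕ → Prop, main = fun n : ℕ => lo < (n : ℝ) ∧ (n : ℝ) ≤ hi / T :=
    ⟨_, rfl⟩
  have hmemS : ∀ {n : ℕ}, n ∈ S → 1 ≤ n ∧ lo ≤ (n : ℝ) ∧ (n : ℝ) < hi := by
    intro n hn
    rw [hSdef, Finset.mem_filter, Finset.mem_Ico] at hn
    exact ⟨hn.1.1, hn.2.1, hn.2.2⟩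
  have hSne : ∀ n ∈ S, n ≠ 0 := fun n hn => by have := (hmemS hn).1; omega
  -- (A) re-indexing
  have hreidx : Sec10B.drSum c' χ j M N lo hi =
      ∑ n ∈ S, ∑ r ∈ n.divisors,
        (if Squarefree r then a n / (Nat.totient r : ℂ) * M n * N (n / r) r else 0) := by
    rw [hadef]; exact hreidx0
  -- (B) hypotheses of the abstract assembly
  have hμ6 : betaMu D 6 = beta6 D := by simp [betaMu]
  have hxfacts : ∀ {n : ℕ}, n ∈ S →
      T < P1 D / n ∧ P1 D / n < P ∧ |Real.log (P1 D / n)| ≤ ell D ^ 9 ∧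
      |Real.log (n / lo)| ≤ 0.004 * ell D ^ 9 ∧ |Real.log (P1 D / n)| ≤ 0.004 * ell D ^ 9 ∧
      |Real.log (hi / n)| ≤ 0.004 * ell D ^ 9 := by
    intro n hn
    obtain ⟨hn1, hlon, hnhi⟩ := hmemS hn
    rw [hlodef] at hlon ⊢
    rw [hhidef] at hnhi ⊢
    rw [hTdef, hPdef]
    exact range_xfacts hL5 hn1 hlon hnhi
  have hLp : ‖deriv χ.LFunction 1‖ ≤ 4 * Real.exp (9 / 2) * ell D ^ 2 :=
    norm_deriv_LFunction_one_le χ (by linarith) hp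
  -- (B1) `M = M₀ + O(eM)`
  have hM : ∀ n ∈ S, ‖M n - M₀ n‖ ≤ |C₂| * (ell D ^ 6)⁻¹ / (0.504 * ell D ^ 9) := by
    intro n hn
    obtain ⟨hn1, hlon, hnhi⟩ := hmemS hn
    obtain ⟨hTx, hxP, -, -, -, -⟩ := hxfacts hn
    have hP2n : P2 D ≤ (n : ℝ) := hP2lo.trans hlon
    have hMn : M n = (1 / (Real.log (P1 D) : ℂ)) * ∑ m ∈ Finset.Ico 1 ⌈P1 D / n⌉₊,
        χ (m : ZMod D) / (m : ℂ) ^ (1 - betaJ c' D j) *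
          (((P1 D / n) / m : ℝ) : ℂ) ^ beta6 D * (Real.log ((P1 D / n) / m) : ℂ) := by
      rw [hMdef]; exact mSum11_eq c' χ hlog2 j hn1 hP2n
    have h82 := H₂' (P1 D / n) hTx hxP
    rw [hμ6] at h82
    have hdiff : M n - M₀ n = (1 / (Real.log (P1 D) : ℂ)) *
        ((∑ m ∈ Finset.Ico 1 ⌈P1 D / n⌉₊, χ (m : ZMod D) / (m : ℂ) ^ (1 - betaJ c' D j) *
          (((P1 D / n) / m : ℝ) : ℂ) ^ beta6 D * (Real.log ((P1 D / n) / m) : ℂ)) -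
          deriv χ.LFunction 1 * frakfW c' D j 6 (P1 D / n)) := by
      rw [hMn, hM₀def]
      have : (Real.log (P1 D) : ℂ) ≠ 0 := by exact_mod_cast hlogP1pos.ne'
      field_simp
    rw [hdiff, norm_mul, norm_div, norm_one, Complex.norm_real, Real.norm_of_nonneg hlogP1pos.le,
      hlogP1]
    have h82' := h82.trans (mul_le_mul_of_nonneg_right (le_abs_self C₂) (by positivity))
    calc 1 / (0.504 * ell D ^ 9) * _ ≤ 1 / (0.504 * ell D ^ 9) * (|C₂| * (ell D ^ 6)⁻¹) := by
          gcongr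
      _ = |C₂| * (ell D ^ 6)⁻¹ / (0.504 * ell D ^ 9) := by ring
  -- (B2) `|M₀| ≤ BM`
  have hM₀ : ∀ n ∈ S, ‖M₀ n‖ ≤ 4 * Real.exp (9 / 2) * ell D ^ 2 * 32 / (0.504 * ell D ^ 9) := by
    intro n hn
    obtain ⟨-, -, hlx, -, -, -⟩ := hxfacts hn
    have hf := norm_frakfW_six_le hcαL hα hαL hL0.le j hlx
    rw [hM₀def]
    simp only
    rw [norm_div, norm_mul, Complex.norm_real, Real.norm_of_nonneg hlogP1pos.le, hlogP1]
    gcongr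
  -- (B3) `|G| ≤ 2`
  have hG : ∀ n ∈ S, ‖G n‖ ≤ 2 := by
    intro n hn
    obtain ⟨-, -, -, h1, h2, h3⟩ := hxfacts hn
    rw [hlodef] at h1
    rw [hhidef] at h3
    rw [hGdef]
    exact norm_fraky1_sub_le hcαL hα hαL hL0.le j h1 h2 h3
  -- (B4) main `n`: Lemma 10.2 (10.9)
  have hN : ∀ n ∈ S, main n → ∀ r ∈ n.divisors, Squarefree r →
      ‖N (n / r) r - c₀ * PiW χ (n / r) r * G n‖ ≤ |C₁| * (ell D ^ 15)⁻¹ := by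
    intro n hn hmain r hr _
    obtain ⟨hn1, -, -⟩ := hmemS hn
    have hr0 : 0 < r := Nat.pos_of_mem_divisors hr
    have hrn : r ∣ n := (Nat.mem_divisors.mp hr).1
    have hnr : n / r * r = n := Nat.div_mul_cancel hrn
    have hd1 : 1 ≤ n / r := Nat.div_pos (Nat.le_of_dvd (by omega) hrn) hr0
    have hcast : ((n / r * r : ℕ) : ℝ) = n := by rw [hnr]
    have hNeq : N (n / r) r = frakv2 c' χ j (n / r) r := by
      rw [hNdef]; exact nSum13_eq_frakv2 c' χ hlog2 j hd1 hr0
    have hmain' : lo < (n : ℝ) ∧ (n : ℝ) ≤ hi / T := by rw [hmaindef] at hmain; exact hmain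
    have h := (H₁' (n / r) r hd1 hr0).2.1 (by rw [hcast]; exact hmain'.1)
      (by rw [hcast]; exact hmain'.2)
    rw [hcast] at h
    rw [hNeq, hGdef, hc₀def]
    simp only
    refine le_trans (le_of_eq ?_) (h.trans ?_)
    · congr 1; ring
    · exact mul_le_mul_of_nonneg_right (le_abs_self _) (by positivity)
  -- (B5) window `n`: Lemma 10.2 (10.11)
  have hW : ∀ n ∈ S, ¬ main n → ∀ r ∈ n.divisors, Squarefree r →
      ‖N (n / r) r‖ ≤ |C₁| * (ell D ^ 7)⁻¹ := by
    intro n hn hmain r hr _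
    obtain ⟨hn1, hlon, hnhi⟩ := hmemS hn
    have hr0 : 0 < r := Nat.pos_of_mem_divisors hr
    have hrn : r ∣ n := (Nat.mem_divisors.mp hr).1
    have hnr : n / r * r = n := Nat.div_mul_cancel hrn
    have hd1 : 1 ≤ n / r := Nat.div_pos (Nat.le_of_dvd (by omega) hrn) hr0
    have hcast : ((n / r * r : ℕ) : ℝ) = n := by rw [hnr]
    have hNeq : N (n / r) r = frakv2 c' χ j (n / r) r := by
      rw [hNdef]; exact nSum13_eq_frakv2 c' χ hlog2 j hd1 hr0
    have hwin : (lo / T < ((n / r * r : ℕ) : ℝ) ∧ ((n / r * r : ℕ) : ℝ) ≤ lo) ∨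
        (hi / T < ((n / r * r : ℕ) : ℝ) ∧ ((n / r * r : ℕ) : ℝ) ≤ hi) ∨
        (P ^ (0.504 : ℝ) / T < ((n / r * r : ℕ) : ℝ) ∧
          ((n / r * r : ℕ) : ℝ) < P ^ (0.504 : ℝ)) := by
      rw [hcast]
      rw [hmaindef] at hmain
      simp only [not_and_or, not_lt, not_le] at hmain
      rcases hmain with h | h
      · left
        refine ⟨?_, h⟩
        calc lo / T < lo := div_lt_self hlo0 hT1'
          _ ≤ n := hlon
      · right; left
        exact ⟨h, hnhi.le⟩
    have h := (H₁' (n / r) r hd1 hr0).2.2.2 hwin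
    rw [hNeq]
    refine h.trans ?_
    exact mul_le_mul_of_nonneg_right (le_abs_self _) (by positivity)
  -- (B6) the (8.10) collapse
  have hPi : ∀ n ∈ S, main n →
      ∑ r ∈ n.divisors with Squarefree r, (1 / (Nat.totient r : ℂ)) * PiW χ (n / r) r =
        (n : ℂ) / (Nat.totient n : ℂ) := fun n hn _ => h810 D χ hq n (hSne n hn)
  ------------------------------------------------------------------
  -- (C) the abstract assembly
  ------------------------------------------------------------------
  have heM0 : 0 ≤ |C₂| * (ell D ^ 6)⁻¹ / (0.504 * ell D ^ 9) := by positivity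
  have hBM0 : 0 ≤ 4 * Real.exp (9 / 2) * ell D ^ 2 * 32 / (0.504 * ell D ^ 9) := by positivity
  have hRA := range_assembly_bound hSne main a M M₀ G N (PiW χ) c₀ heM0 hBM0 hPi hM hM₀ hG hN hW
  ------------------------------------------------------------------
  -- (D) main term, weights, constants
  ------------------------------------------------------------------
  have hMT : 500 * deriv χ.LFunction 1 ^ 2 / (0.504 * Sec10B.logP D ^ 2) *
        Sec10B.nAvg c' χ j lo hi
          (fun n => frakfW c' D j 6 (P ^ (0.504 : ℝ) / n) * (-1 + fraky1 c' D j n)) =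
      ∑ n ∈ S, a n * ((n : ℂ) / (Nat.totient n : ℂ)) * (M₀ n * c₀ * G n) := by
    rw [hadef, hM₀def, hGdef, hc₀def]
    exact hMT0
  have hweight : ∀ n ∈ S, ‖a n‖ * ((n : ℝ) / Nat.totient n) ≤ ((n : ℝ) / Nat.totient n) ^ 5 / n := by
    intro n hn
    have hn0 := hSne n hn
    have hχ : ‖χ (n : ZMod D)‖ ≤ 1 := DirichletCharacter.norm_le_one χ _
    have hlam := norm_lamZero_le c' D j hn0
    have hr1 := one_le_self_div_totient hn0
    rw [hadef]
    simp only
    rw [norm_div, norm_mul, Complex.norm_real, Real.norm_eq_abs, abs_norm, Complex.norm_natCast]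
    calc ‖χ (n : ZMod D)‖ * ‖lamZero c' D j n‖ / n * ((n : ℝ) / Nat.totient n)
        ≤ 1 * ((n : ℝ) / Nat.totient n) ^ 4 / n * ((n : ℝ) / Nat.totient n) := by gcongr
      _ = ((n : ℝ) / Nat.totient n) ^ 5 / n := by ring
  have hWmain_le : ∑ n ∈ S.filter main, ‖a n‖ * ((n : ℝ) / Nat.totient n) ≤
      Real.exp 64 * ell D ^ 9 := by
    have hfull := weight_sum_full hL5 S (fun n hn => by
      obtain ⟨h1, h2, h3⟩ := hmemS hn
      rw [hlodef] at h2; rw [hhidef] at h3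
      exact ⟨h1, h2, h3⟩)
    calc ∑ n ∈ S.filter main, ‖a n‖ * ((n : ℝ) / Nat.totient n)
        ≤ ∑ n ∈ S.filter main, ((n : ℝ) / Nat.totient n) ^ 5 / n :=
          Finset.sum_le_sum fun n hn => hweight n (Finset.mem_of_mem_filter n hn)
      _ ≤ ∑ n ∈ S, ((n : ℝ) / Nat.totient n) ^ 5 / n :=
          Finset.sum_le_sum_of_subset_of_nonneg (Finset.filter_subset _ _) fun n _ _ => by
            positivity
      _ ≤ Real.exp 64 * ell D ^ 9 := hfull
  have hWwin_le : ∑ n ∈ S.filter (fun n => ¬ main n), ‖a n‖ * ((n : ℝ) / Nat.totient n) ≤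
      2 * Real.exp 64 * ell D ^ 2 := by
    have hwin := weight_sum_window hL5 (S.filter (fun n => ¬ main n)) (fun n hn => by
      rw [Finset.mem_filter] at hn
      obtain ⟨hnS, hnm⟩ := hn
      obtain ⟨h1, h2, h3⟩ := hmemS hnS
      rw [hmaindef] at hnm
      simp only [not_and_or, not_lt, not_le] at hnm
      rw [hlodef] at h2 hnm; rw [hhidef] at h3 hnm; rw [hTdef] at hnm
      exact ⟨h1, h2, h3, hnm⟩)
    calc ∑ n ∈ S.filter (fun n => ¬ main n), ‖a n‖ * ((n : ℝ) / Nat.totient n)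
        ≤ ∑ n ∈ S.filter (fun n => ¬ main n), ((n : ℝ) / Nat.totient n) ^ 5 / n :=
          Finset.sum_le_sum fun n hn => hweight n (Finset.mem_of_mem_filter n hn)
      _ ≤ 2 * Real.exp 64 * ell D ^ 2 := hwin
  have hc₀' : ‖c₀‖ ≤ 2000 * Real.exp (9 / 2) * (ell D ^ 7)⁻¹ := by
    rw [hc₀def, norm_div, norm_mul, Complex.norm_real, Real.norm_of_nonneg (by rw [hlogP]; positivity),
      hlogP]
    have h500 : ‖(500 : ℂ)‖ = 500 := by norm_num
    rw [h500, div_eq_mul_inv]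
    have : (2000 : ℝ) * Real.exp (9 / 2) * (ell D ^ 7)⁻¹ =
        500 * (4 * Real.exp (9 / 2) * ell D ^ 2) * (ell D ^ 9)⁻¹ := by
      field_simp; ring
    rw [this]
    gcongr
  obtain ⟨hKmain, hKwin⟩ := consts_bound (C₁ := C₁) (C₂ := C₂) hL5 (norm_nonneg c₀) hc₀'
  ------------------------------------------------------------------
  -- (E) conclusion
  ------------------------------------------------------------------
  rw [hreidx, hMT]
  refine hRA.trans ?_
  rw [hαeq]
  exact final_bound hL1 hε hK₁0 hK₂0 (by positivity) (by positivity)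
    hWmain_le hWwin_le hKmain hKwin (by rw [hX] at hLX; linarith)

end Literature.NumberTheory.LFunctions.Zhang2022.Skeleton
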